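import Literature.Computability.QuantumComplexity.CoreDescUniform
import Literature.Computability.Complexity.CodeFPArithExpr
import Literature.Computability.Cryptography.QuantumCircuitDescFP
import Summits.QuantumAdvantage.QuantumAdvantage.Theorems.SymplecticPurityNoFreeFrameUniform
import Summits.QuantumAdvantage.QuantumAdvantage.Theorems.SymplecticPurityGoldDefs

/-!
# Route `SymplecticPurity`, crux `DeqThesis` (stmt-QuantumAdvantage-0242), line `Sketch` —
# the two-Gold-map witness family is oracle-free and polynomial-time uniform

Registered sub-goal `stub_goldUniform`: `goldFamily.IsOracleFree ∧ goldFamily.IsUniform` for the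
two-Gold-map family of `SymplecticPurityGoldDefs.lean` (`n + n` ancillas; a Hadamard on every input
wire followed by the compiled reversible program `goldOpsA n = cubeOpsA n ++ pentOpsA n`).

This is the verbatim analogue of `SymplecticPurityNoFreeFrameUniform.lean` (the cube family), whose
lemmas are reused: the description `sigmaEncode ⟨n, n + n, goldCirc n⟩` is computed from `1ⁿ` in the
typed `FP` algebra `CodeFP` (Arora–Barak 2009 §6.2, as set up in the tree by
`QuantumCircuitDescFP.lean`, `CodeFP*.lean` and the abstract-gate layer of `CoreDescAbstract.lean` /
`CoreDescBlockFP.lean`). The only new ingredients are the fifth-power program `pentOpsA n` (two nested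
`flatMap`s over `[0, …, n-1]` with exponents `5i`, `i + 4j` and targets `n + n + l`), the wire
reduction mod `n + (n + n)`, the Hadamard layer cast `Fin.castAdd (n + n)`, and the unary ancilla
count `1ⁿ ↦ 1^{n+n}` (`unAdd`).
-/

noncomputable section

set_option linter.dupNamespace false -- D-0017: single-problem summit ⇒ `QuantumAdvantage.QuantumAdvantage` by design

namespace Summit.QuantumAdvantage.QuantumAdvantage.Theorems.SymplecticPurity

open Literature.Computability.QuantumComplexity Literature.Computability.Cryptography
open Literature.Computability.Complexity Literature.Computability.Complexity.CodeFP AJLCore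
open _root_.Computability

/-! ### The program `pentOpsA` in `FP` -/

/-- Binary value of twice the unary first component: `(1ⁿ, b) ↦ n + n`. -/
theorem unFst_twice {β : Type} {eβ : β → List Bool} : CodeFP (pairE unE eβ) natE (fun p => p.1 + p.1) :=
  (natAdd.comp (unFst_toNat.pair unFst_toNat)).congr fun _ => rfl

/-- The linear chunk of input wire `i` of the fifth-power program:
`(1ⁿ, i) ↦ [CNOT i (n + n + l) | l ∈ cubeExps (n/2) (5i)]`. -/
theorem pentLinChunk_fp : CodeFP (pairE unE natE) (rawE clopE)
    (fun p => (cubeExps (p.1 / 2) (5 * p.2)).map fun l => ClOp.cnot p.2 (p.1 + p.1 + l)) := by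
  have hinner : CodeFP (pairE (pairE unE natE) natE) clopE
      (fun t => ClOp.cnot t.1.2 (t.1.1 + t.1.1 + t.2)) :=
    clop_cnot (fst _ _).snd' (natAdd.comp ((unFst_twice.comp (fst _ _)).pair (snd _ _)))
  have hexps : CodeFP (pairE unE natE) (rawE natE) (fun p => cubeExps (p.1 / 2) (5 * p.2)) :=
    cubeExps_fp.comp ((natDiv.comp (unFst_toNat.pair (const _ 2))).pair (natMul.comp ((const _ 5).pair (snd _ _))))
  exact ((map hinner).comp ((CodeFP.id _).pair hexps)).congr fun _ => rfl

/-- **`1ⁿ ↦ pentLinOps n` in `FP`.** -/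
theorem pentLinOps_fp : CodeFP unE (rawE clopE) pentLinOps := by
  have h := (map (σ := ℕ) (eσ := unE) pentLinChunk_fp).comp ((CodeFP.id _).pair urange)
  exact ((flatten clopE).comp h).congr fun n => by
    rw [pentLinOps, List.flatMap_def]; rfl

/-- The quadratic chunk of a pair of input wires of the fifth-power program:
`((1ⁿ, i), j) ↦ if i = j then [] else [TOF i j (n + n + l) | l ∈ cubeExps (n/2) (i + 4j)]`. -/
theorem pentQuadChunk_fp : CodeFP (pairE (pairE unE natE) natE) (rawE clopE)
    (fun t => if t.1.2 = t.2 then [] else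
      (cubeExps (t.1.1 / 2) (t.1.2 + 4 * t.2)).map fun l => ClOp.toffoli t.1.2 t.2 (t.1.1 + t.1.1 + l)) := by
  have hinner : CodeFP (pairE (pairE (pairE unE natE) natE) natE) clopE
      (fun u => ClOp.toffoli u.1.1.2 u.1.2 (u.1.1.1 + u.1.1.1 + u.2)) :=
    clop_toffoli (fst _ _).fst'.snd' (fst _ _).snd'
      (natAdd.comp ((unFst_twice.comp (fst _ _).fst').pair (snd _ _)))
  have hexps : CodeFP (pairE (pairE unE natE) natE) (rawE natE)
      (fun t => cubeExps (t.1.1 / 2) (t.1.2 + 4 * t.2)) :=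
    cubeExps_fp.comp ((natDiv.comp ((unFst_toNat.comp (fst _ _)).pair (const _ 2))).pair
      (natAdd.comp ((fst _ _).snd'.pair (natMul.comp ((const _ 4).pair (snd _ _))))))
  have hlist : CodeFP (pairE (pairE unE natE) natE) (rawE clopE)
      (fun t => (cubeExps (t.1.1 / 2) (t.1.2 + 4 * t.2)).map fun l =>
        ClOp.toffoli t.1.2 t.2 (t.1.1 + t.1.1 + l)) :=
    ((map hinner).comp ((CodeFP.id _).pair hexps)).congr fun _ => rfl
  have heq : CodeFP (pairE (pairE unE natE) natE) bitE (fun t => decide (t.1.2 = t.2)) :=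
    natEq.comp ((fst _ _).snd'.pair (snd _ _))
  exact (heq.ite (const _ []) hlist).congr fun t => by
    by_cases h : t.1.2 = t.2 <;> simp [h]

/-- The quadratic chunks of input wire `i` of the fifth-power program: `(1ⁿ, i) ↦ flatMap over j < n`. -/
theorem pentQuadRow_fp : CodeFP (pairE unE natE) (rawE clopE)
    (fun p => (List.range p.1).flatMap fun j => if p.2 = j then [] else
      (cubeExps (p.1 / 2) (p.2 + 4 * j)).map fun l => ClOp.toffoli p.2 j (p.1 + p.1 + l)) := by
  have hrange : CodeFP (pairE unE natE) (rawE natE) (fun p => List.range p.1) := urange.comp (fst _ _)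
  have h := (map pentQuadChunk_fp).comp ((CodeFP.id _).pair hrange)
  exact ((flatten clopE).comp h).congr fun p => by rw [List.flatMap_def]; rfl

/-- **`1ⁿ ↦ pentQuadOps n` in `FP`.** -/
theorem pentQuadOps_fp : CodeFP unE (rawE clopE) pentQuadOps := by
  have h := (map (σ := ℕ) (eσ := unE) pentQuadRow_fp).comp ((CodeFP.id _).pair urange)
  exact ((flatten clopE).comp h).congr fun n => by
    rw [pentQuadOps, List.flatMap_def]; rfl

/-- **`1ⁿ ↦ pentOpsA n` in `FP`.** -/
theorem pentOpsA_fp : CodeFP unE (rawE clopE) pentOpsA :=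
  (clopAppend pentLinOps_fp pentQuadOps_fp).congr fun _ => rfl

/-! ### The program `goldOpsA` in `FP` -/

/-- **`1ⁿ ↦ goldOpsA n` in `FP`.** -/
theorem goldOpsA_fp : CodeFP unE (rawE clopE) goldOpsA :=
  (clopAppend cubeOpsA_fp pentOpsA_fp).congr fun _ => rfl

/-- Reducing the wires of a program computed from `1ⁿ` modulo a modulus computed from `1ⁿ`. -/
theorem opsMod_fp {ops : ℕ → List (ClOp ℕ)} {m : ℕ → ℕ} (hops : CodeFP unE (rawE clopE) ops)
    (hm : CodeFP unE natE m) :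
    CodeFP unE (rawE clopE) (fun n => (ops n).map (ClOp.map fun v => v % m n)) := by
  have hop : CodeFP (pairE unE clopE) clopE (fun p => p.2.map fun v => v % m p.1) := by
    have hT : CodeFP (pairE unE clopE) ctE (fun t => clopTuple t.2) :=
      (transparent (eα := clopE) (eβ := ctE) (g := clopTuple) fun _ => rfl).comp (snd _ _)
    have hmq : CodeFP (pairE (pairE unE clopE) natE) natE (fun q => q.2 % m q.1.1) :=
      natMod.comp ((snd _ _).pair (hm.comp (fst _ _).fst'))
    have hws : CodeFP (pairE unE clopE) (rawE natE)
        (fun t => (clopTuple t.2).2.map fun v => v % m t.1) :=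
      ((map (g := fun q : (ℕ × ClOp ℕ) × ℕ => q.2 % m q.1.1) hmq).comp
        ((CodeFP.id _).pair hT.snd')).congr fun _ => rfl
    exact clop_of_tuple (hT.fst'.pair hws) fun t => AJLCore.BP.clopTuple_map _ _
  exact ((map hop).comp ((CodeFP.id _).pair hops)).congr fun _ => rfl

/-- `1ⁿ ↦` the two-Gold-map program with wires reduced mod `n + (n + n)` (the values of the
`Fin`-transport `goldOpsFin`). -/
theorem goldOpsMod_fp :
    CodeFP unE (rawE clopE) (fun n => (goldOpsA n).map (ClOp.map fun v => v % (n + (n + n)))) :=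
  opsMod_fp goldOpsA_fp ((natAdd.comp (natOfUn.pair (natAdd.comp (natOfUn.pair natOfUn)))).congr
    fun _ => rfl)


/-! ### The description of the witness circuit -/

/-- The two-Gold-map witness circuits are oracle-free. -/
theorem goldCirc_isOracleFree (n : ℕ) : (goldCirc n).IsOracleFree := by
  intro g hg
  simp only [goldCirc, goldGates] at hg
  split_ifs at hg with hn
  · rw [List.mem_append, List.mem_map] at hg
    rcases hg with ⟨i, -, rfl⟩ | hg
    · trivial
    · exact revCompile_isOracleFree _ g hg
  · simp at hg

/-- **The two-Gold-map witness family is oracle-free.** -/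
theorem goldFamily_isOracleFree : goldFamily.IsOracleFree := fun n => goldCirc_isOracleFree n

/-- The abstract gate list of the two-Gold-map witness circuit: the Hadamard layer on `0 … n-1`
followed by the abstractly compiled program with wires reduced mod `n + (n + n)`. -/
theorem map_toAG_goldGates (n : ℕ) :
    (goldGates n).map toAG =
      hLayerA (List.range n) ++ progA ((goldOpsA n).map (ClOp.map fun v => v % (n + (n + n)))) := by
  unfold goldGates
  split_ifs with hn
  · have e1 : (List.finRange n).map (fun i => hOn (Fin.castAdd (n + n) i)) =
        ((List.finRange n).map (Fin.castAdd (n + n))).map hOn := by rw [List.map_map]; rfl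
    rw [List.map_append, e1, map_toAG_map_hOn, List.map_map, map_toAG_revCompile_toRevList,
      goldOpsFin, map_val_map_finOf]
    congr 2
    rw [← List.map_coe_finRange_eq_range (n := n)]
    rfl
  · have h0 : n = 0 := by omega
    subst h0
    rfl

/-- The description of the two-Gold-map witness circuit through its abstract gate list. -/
theorem sigmaEncode_goldCirc (n : ℕ) :
    QCircuit.sigmaEncode (G := cliffordT) ⟨n, n + n, goldCirc n⟩ =
      boolPair (encodeNat n) (boolPair (unaryEncodeNat (n + n))
        (rawE agE (hLayerA (List.range n) ++
          progA ((goldOpsA n).map (ClOp.map fun v => v % (n + (n + n))))))) := by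
  rw [QCircuit.sigmaEncode_eq, encode_eq_rawE (goldCirc n) (goldCirc_isOracleFree n)]
  simp only [goldCirc, map_toAG_goldGates]

/-- The abstract gate list of the two-Gold-map witness circuit in `FP`. -/
theorem goldGatesA_fp : CodeFP unE (rawE agE0)
    (fun n => hLayerA (List.range n) ++ progA ((goldOpsA n).map (ClOp.map fun v => v % (n + (n + n))))) :=
  agAppend (hLayerA_fp.comp urange) (progA_fp.comp goldOpsMod_fp)

/-- **The description of the two-Gold-map witness family in polynomial time.** -/
theorem goldDesc_codeFP : CodeFP unE (QCircuit.sigmaEncode (G := cliffordT))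
    (fun n => (⟨n, goldFamily.ancillas n, goldFamily.circ n⟩ : Σ n m : ℕ, QCircuit cliffordT (n + m))) := by
  have hc : CodeFP unE (rawE agE)
      (fun n => hLayerA (List.range n) ++ progA ((goldOpsA n).map (ClOp.map fun v => v % (n + (n + n))))) :=
    ((map₀ agE_of_agE0).comp goldGatesA_fp).congr fun _ => List.map_id _
  have h2 : CodeFP unE unE (fun n => n + n) :=
    (unAdd.comp ((CodeFP.id _).pair (CodeFP.id _))).congr fun _ => rfl
  have h : CodeFP unE (pairE natE (pairE unE (rawE agE)))
      (fun n => (n, n + n, hLayerA (List.range n) ++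
        progA ((goldOpsA n).map (ClOp.map fun v => v % (n + (n + n)))))) :=
    natOfUn.pair (h2.pair hc)
  exact h.recodeOut fun n => by
    show _ = QCircuit.sigmaEncode (G := cliffordT) ⟨n, n + n, goldCirc n⟩
    rw [sigmaEncode_goldCirc]; rfl

/-- **The two-Gold-map witness family is polynomial-time uniform.** -/
theorem goldFamily_isUniform : goldFamily.IsUniform := goldDesc_codeFP.polyTimeComputable

/-- Registered sub-goal `stub_goldUniform` of line `Sketch` (crux `DeqThesis`): **the two-Gold-map
witness family is oracle-free and polynomial-time uniform.** -/
theorem stub_goldUniform : goldFamily.IsOracleFree ∧ goldFamily.IsUniform :=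
  ⟨goldFamily_isOracleFree, goldFamily_isUniform⟩

end Summit.QuantumAdvantage.QuantumAdvantage.Theorems.SymplecticPurity
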